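import Literature.AlgebraicGeometry.AbelianSchemes.WeilUnitKernelOrthogonal      -- ★ (h4) §2 `Ker φ ⟂ φ^∨(B̂[n])`, ★ `weilUnit`, `weilUnit_baseChange`
import Literature.AlgebraicGeometry.AbelianSchemes.AbelianSchemeOverMulNFiniteFlat  -- ★ `[n]` finite flat
import Literature.AlgebraicGeometry.AbelianSchemes.AbelianSchemeOverMulNSurjective  -- ★ `[n]` surjective
import Literature.AlgebraicGeometry.AbelianSchemes.WeilPairingCharacter          -- ★ `ptSection`, `Sections.ext_fst`, `sectionAlong_left_fst`
import Literature.AlgebraicGeometry.AbelianSchemes.SerreTensorBaseChange          -- ★ `isCommMonObj_baseChange`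
import HarnessLib

/-!
# The kernel of a homomorphism through which `n·λ` descends is ISOTROPIC for the `λ`-twisted Weil pairing: `e_n(x, λ y) = 1` for `x, y ∈ Ker q`
# ([Mumford AV] §23 Thm. 2 (p. 231), §20 (I) (p. 186); [Milne AV] I §11, §13)

Topic `Literature/AlgebraicGeometry/AbelianSchemes`; namespace `Literature.AlgebraicGeometry.AbelianSchemes.AbelianSchemeOver.DualPair` (continues ★
`WeilUnitKernelOrthogonal`).  THEOREMS ONLY (no definition, no named fact, no instance, no notation, no `sorry` when landed).  Cell `hodgecm-mathlib`
(D-0151), P6 «MOD programme» (crux hLiu418 = stmt-HodgeConjecture-24832, `--supports`, count-neutral), half-A line L2, LA2-plan (g0) ρ-ROAD v2 organ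
**(ρ2′) = (ISO-q) ∘ (W-λ) ∘ (BLK)** (ruling 2026-09-02T05:39:00Z), piece **(ISO-q)** — the one piece ★ `WeilUnitKernelOrthogonal`'s docstring prices as «NOT HERE …
the descent theorem [MumfordAV1970] §23 Thm. 2».  HONEST LABEL: HC_CM is proved only modulo the 2 remaining named inputs (hLiu418 24832, h413 24833) until rung 0
closes; this file is generic and discharges none of them.

THE MATHEMATICS ([MumfordAV1970] §23 Thm. 2 p. 231: if `L = q^*M` descends through the isogeny `q`, then `Ker q` is totally isotropic for `e^L`; here
`L ↔ n·λ = q ≫ λ_C ≫ q^∨`, and `e^{nλ}(x, y) = e_n(x, λ y)`, [MilneAV2008] I §13).  NO theta groups: let `q : A → C` be a homomorphism of abelian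
`S`-schemes, `λ : A → Â`, `λ_C : C → Ĉ` homomorphisms with the DESCENT ROW (r3) `q ≫ λ_C ≫ q^∨ = λ ≫ [n]_Â` (★ `dualIsogenyOver`, ★ `mulN` — the row shape
of ★ `RoofTargetUnique.roof_target_unique` ∕ the P6a reader `Roof₀`).  For a `T`-point `y` of `A` killed by `q` and an `n`-torsion section `x` of `A_T`
killed by `q_T`: `[n] : A → A` is an fppf epimorphism, so on the finite flat cover `T′ := T ×_{y, A_T, [n]} A_T → T` there is `y′` with `n·y′ = y|_{T′}`;
then `λ(y|_{T′}) = λ(n y′) = (λ ≫ [n])(y′) = q^∨(λ_C(q y′))` with `c′ := λ_C(q y′)` an `n`-TORSION point of `Ĉ` (`n·c′ = λ_C q (n y′) = λ_C q y = 0`),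
so ★ `weilUnit_comp_dualIsogenyOver_eq_one_of_comp_baseChangeHom_eq_one` («`Ker q ⟂ q^∨(Ĉ[n])`», [MumfordAV1970] §20 (I)) gives `e_n(x, λ y)|_{T′} = 1`
(★ `weilUnit_baseChange`), and a unit of `Γ(T, 𝒪_T)` that becomes `1` on a faithfully flat cover is `1`.

* **`weilUnit_comp_lam_eq_one_of_comp_eq_one`** — THE HEAD: `e_n^A(x, y ≫ λ) = 1` for `x ≫ q_T = 1`, `y ≫ q = 1` (the torsion witness of `y ≫ λ` is a free
  hypothesis, as in ★ §2).

## References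
* [MumfordAV1970] D. Mumford, *Abelian Varieties* (1970), §23 Thm. 2 (p. 231), §20 (I) (p. 186), (IV) (p. 187), §15 Thm. 1 (p. 143).
* [MilneAV2008] J. S. Milne, *Abelian Varieties* (2008), I §11, I §13 (the `e^λ_n`-pairing).
* [GortzWedhorn2020] U. Görtz, T. Wedhorn, *Algebraic Geometry I*, 2nd ed. (2020), Section (4.7) (p. 108); (14.20) (fpqc descent of sections).
-/

set_option autoImplicit false

noncomputable section

-- `TopCat.Presheaf`/`Scheme.Modules` are not reducible (as in ★ `WeilUnitOfTorsionPoint`, ★ `WeilUnitKernelOrthogonal`).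
set_option backward.isDefEq.respectTransparency false

universe u

open CategoryTheory CategoryTheory.Limits AlgebraicGeometry MonoidalCategory CartesianMonoidalCategory TopologicalSpace
  Opposite
open scoped MonObj

namespace Literature.AlgebraicGeometry.AbelianSchemes.AbelianSchemeOver.DualPair

open TorsionPairing Literature.AlgebraicGeometry.RelativeSpec Literature.AlgebraicGeometry.Modules Literature.AlgebraicGeometry.Motives
  Literature.AlgebraicGeometry.RelativeSpec.ActionOver

/-! ## §0 Plumbing: sections are injective along an epimorphism of schemes; sections along `t` commute with `φ_T` -/

section Plumbing

/-- **`Γ(T, 𝒪_T) → Γ(T′, 𝒪_{T′})` IS INJECTIVE ALONG AN EPIMORPHISM `t : T′ → T` OF SCHEMES** (e.g. `t` flat and surjective, Mathlib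
`Flat.epi_of_flat_of_surjective` — faithfully flat descent of functions, [GortzWedhorn2020] (14.20)): a global function `a` is the morphism
`T → Spec Γ(T, 𝒪_T)[X]`, `X ↦ a` (Γ–Spec adjunction), and two such morphisms that agree after `t` agree. [cite: GortzWedhorn2020, Thm. 14.66] -/
theorem appTop_injective_of_epi {T T' : Scheme.{u}} (t : T' ⟶ T) [Epi t] : Function.Injective t.appTop := by
  intro a b h
  let B : CommRingCat.{u} := CommRingCat.of (Polynomial Γ(T, ⊤))
  let φ : Γ(T, ⊤) → (B ⟶ Γ(T, ⊤)) := fun c => CommRingCat.ofHom (Polynomial.aeval c).toRingHom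
  have hφ : φ a ≫ t.appTop = φ b ≫ t.appTop := by
    ext1
    refine Polynomial.ringHom_ext (fun r => ?_) ?_
    · change t.appTop ((Polynomial.aeval a) (Polynomial.C r)) = t.appTop ((Polynomial.aeval b) (Polynomial.C r))
      rw [Polynomial.aeval_C, Polynomial.aeval_C]
    · change t.appTop ((Polynomial.aeval a) Polynomial.X) = t.appTop ((Polynomial.aeval b) Polynomial.X)
      rw [Polynomial.aeval_X, Polynomial.aeval_X]
      exact h
  have key : ∀ c : Γ(T, ⊤),
      t ≫ (ΓSpec.adjunction.homEquiv T (op B)) (φ c).op = (ΓSpec.adjunction.homEquiv T' (op B)) ((φ c ≫ t.appTop).op) := fun c => by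
    rw [← Adjunction.homEquiv_naturality_left]
    rfl
  have hg : (ΓSpec.adjunction.homEquiv T (op B)) (φ a).op = (ΓSpec.adjunction.homEquiv T (op B)) (φ b).op := by
    rw [← cancel_epi t, key, key, hφ]
  have hφab : φ a = φ b := Quiver.Hom.op_inj ((ΓSpec.adjunction.homEquiv T (op B)).injective hg)
  have := congrArg (fun ψ : B ⟶ Γ(T, ⊤) => ψ.hom Polynomial.X) hφab
  change (Polynomial.aeval a) Polynomial.X = (Polynomial.aeval b) Polynomial.X at this
  rwa [Polynomial.aeval_X, Polynomial.aeval_X] at this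

variable {S : Scheme.{u}} {A C : AbelianSchemeOver S} (q : A.X ⟶ C.X) {T T' : Scheme.{u}} (f : T ⟶ S) (t : T' ⟶ T)

/-- **SECTIONS ALONG `t` COMMUTE WITH `q_T`**: `(k along t) ≫ q_{T′} = (k ≫ q_T) along t` (both have `pr_C`-component `t ≫ k ≫ pr_A ≫ q`).
[cite: GortzWedhorn2020, Section (4.7), (4.7.1) (p. 108)] -/
theorem sectionAlong_comp_baseChangeHom (k : (A.baseChange f).Sections) :
    A.sectionAlong f t k ≫ baseChangeHom q (t ≫ f) = C.sectionAlong f t (k ≫ baseChangeHom q f) := by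
  apply Sections.ext_fst
  rw [Over.comp_left, Category.assoc, baseChangeHom_left_comp_fst, ← Category.assoc, sectionAlong_left_fst,
    sectionAlong_left_fst, Over.comp_left]
  simp only [Category.assoc, baseChangeHom_left_comp_fst]

end Plumbing

/-! ## §1 The head -/

section Descent

variable {S : Scheme.{u}} {A C : AbelianSchemeOver S} [IsReduced S] [IsLocallyNoetherian S] (q : A.X ⟶ C.X) [IsMonHom q]
  (DA : A.DualPair) (DC : C.DualPair)
  (hDA : Nonempty ((Scheme.Modules.pullback (DualPair.unitHatSlice DA)).obj DA.P ≅ SheafOfModules.unit _))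
  (hDC : Nonempty ((Scheme.Modules.pullback (DualPair.unitHatSlice DC)).obj DC.P ≅ SheafOfModules.unit _)) (n : ℕ)
  (lam : A.X ⟶ DA.hat.X) [IsMonHom lam] (lamC : C.X ⟶ DC.hat.X) [IsMonHom lamC]
  {T : Scheme.{u}} (f : T ⟶ S) [IsLocallyNoetherian T] [IsCommMonObj A.X] [IsCommMonObj C.X]
  [IsCommMonObj (A.baseChange f).X] [IsCommMonObj (C.baseChange f).X]

include hDC in
/-- **`Ker q` IS ISOTROPIC FOR `e_n(·, λ ·)` WHEN `n·λ` DESCENDS THROUGH `q`** ([MumfordAV1970] §23 Thm. 2, scheme-theoretically, without theta groups): if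
`q ≫ λ_C ≫ q^∨ = λ ≫ [n]_Â` (`n ≠ 0`), then for every `n`-torsion section `x` of `A_T` killed by `q_T` and every `T`-point `y` of `A` killed by `q`,
`e_n^A(x, y ≫ λ) = 1`.  (fppf-locally `y = n·y′`, so `λ y = q^∨(λ_C(q y′))` with `λ_C(q y′) ∈ Ĉ[n]`, and ★ `Ker q ⟂ q^∨(Ĉ[n])`; units descend along the
finite flat cover `[n]`.)  The torsion witness `hc` of `y ≫ λ` is a free hypothesis (it holds: `(y ≫ λ)^n = y ≫ q ≫ λ_C ≫ q^∨ = 1`).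
[cite: MumfordAV1970, §23 Thm. 2 (p. 231); §20 (I) (p. 186)] [cite: MilneAV2008, I §13] -/
theorem weilUnit_comp_lam_eq_one_of_comp_eq_one (hn : n ≠ 0)
    (r3 : q ≫ lamC ≫ dualIsogenyOver q DA DC = lam ≫ DA.hat.mulN n)
    (x : (A.baseChange f).torsionSections n) (hx : (x : (A.baseChange f).Sections) ≫ baseChangeHom q f = 1)
    (y : Over.mk f ⟶ A.X) (hy : y ≫ q = 1) (hc : (y ≫ lam) ^ n = 1) :
    DA.weilUnit hDA n f (y ≫ lam) hc x = 1 := by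
  -- (1) the finite flat cover `t : T′ → T` on which `y` becomes divisible by `n`
  let sy : (A.baseChange f).Sections := A.ptSection f y
  haveI : IsFinite ((A.baseChange f).mulN n).left := (A.baseChange f).isFinite_pow_id_left_of_ne_zero hn
  haveI : Flat ((A.baseChange f).mulN n).left := (A.baseChange f).flat_pow_id_left_of_ne_zero hn
  haveI : Surjective ((A.baseChange f).mulN n).left := (A.baseChange f).surjective_pow_id_left_of_ne_zero hn
  let t : pullback sy.left ((A.baseChange f).mulN n).left ⟶ T := pullback.fst sy.left ((A.baseChange f).mulN n).left
  let y₀ : pullback sy.left ((A.baseChange f).mulN n).left ⟶ (A.baseChange f).X.left := pullback.snd sy.left ((A.baseChange f).mulN n).left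
  have hcond : t ≫ sy.left = y₀ ≫ ((A.baseChange f).mulN n).left := pullback.condition
  haveI : IsFinite t := MorphismProperty.pullback_fst _ _ inferInstance
  haveI : Flat t := MorphismProperty.pullback_fst _ _ inferInstance
  haveI : Surjective t := MorphismProperty.pullback_fst _ _ inferInstance
  haveI : Epi t := Flat.epi_of_flat_of_surjective t
  haveI : IsLocallyNoetherian (pullback sy.left ((A.baseChange f).mulN n).left) := LocallyOfFiniteType.isLocallyNoetherian t
  haveI : IsCommMonObj (A.baseChange (t ≫ f)).X := isCommMonObj_baseChange _
  haveI : IsCommMonObj (C.baseChange (t ≫ f)).X := isCommMonObj_baseChange _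
  -- (2) the `n`-th root `y′` of `y` over `T′`
  have hy₀T : y₀ ≫ (A.baseChange f).X.hom = t := by
    have h1 : y₀ ≫ (A.baseChange f).X.hom = (y₀ ≫ ((A.baseChange f).mulN n).left) ≫ (A.baseChange f).X.hom := by
      rw [Category.assoc, Over.w]
    rw [h1, ← hcond, Category.assoc, Over.w sy]
    exact Category.comp_id _
  let y' : Over.mk (t ≫ f) ⟶ A.X := Over.homMk (y₀ ≫ pullback.fst A.X.hom f) (by
    change (y₀ ≫ pullback.fst A.X.hom f) ≫ A.X.hom = t ≫ f
    rw [Category.assoc, pullback.condition, ← Category.assoc]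
    exact congrArg (· ≫ f) hy₀T)
  have key1 : y' ≫ A.mulN n = pointAlong f t y := by
    ext1
    change (y₀ ≫ pullback.fst A.X.hom f) ≫ (A.mulN n).left = t ≫ y.left
    rw [Category.assoc, ← baseChangeHom_left_comp_fst (A.mulN n) f, baseChangeHom_mulN A f n, ← Category.assoc, ← hcond,
      Category.assoc]
    exact congrArg (t ≫ ·) (A.ptSection_left_fst f y)
  -- (3) the `n`-torsion point `c′ := λ_C (q y′)` of `Ĉ` with `q^∨ c′ = λ y` over `T′`
  let c' : Over.mk (t ≫ f) ⟶ DC.hat.X := y' ≫ q ≫ lamC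
  have hmulC : C.mulN n ≫ lamC = lamC ≫ DC.hat.mulN n := by
    rw [mulN_def, mulN_def, MonObj.pow_comp, MonObj.comp_pow, Category.id_comp, Category.comp_id]
  have hmulA : A.mulN n ≫ q = q ≫ C.mulN n := by
    rw [mulN_def, mulN_def, MonObj.pow_comp, MonObj.comp_pow, Category.id_comp, Category.comp_id]
  have hmulL : A.mulN n ≫ lam = lam ≫ DA.hat.mulN n := by
    rw [mulN_def, mulN_def, MonObj.pow_comp, MonObj.comp_pow, Category.id_comp, Category.comp_id]
  have hc'n : c' ^ n = 1 := by
    have h1 : c' ^ n = c' ≫ DC.hat.mulN n := by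
      change c' ^ n = c' ≫ (𝟙 DC.hat.X) ^ n
      rw [MonObj.comp_pow, Category.comp_id]
    rw [h1]
    change (y' ≫ q ≫ lamC) ≫ DC.hat.mulN n = 1
    rw [Category.assoc, Category.assoc, ← hmulC, ← Category.assoc q, ← hmulA, ← Category.assoc, ← Category.assoc, key1]
    change (((Over.homMk t rfl : Over.mk (t ≫ f) ⟶ Over.mk f) ≫ y) ≫ q) ≫ lamC = 1
    rw [Category.assoc _ y q, hy, MonObj.comp_one, MonObj.one_comp]
  have key3 : c' ≫ dualIsogenyOver q DA DC = pointAlong f t (y ≫ lam) := by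
    change (y' ≫ q ≫ lamC) ≫ dualIsogenyOver q DA DC = (Over.homMk t rfl : Over.mk (t ≫ f) ⟶ Over.mk f) ≫ y ≫ lam
    rw [Category.assoc, Category.assoc, r3, ← hmulL, ← Category.assoc, key1, Category.assoc]
  have hc'' : (c' ≫ dualIsogenyOver q DA DC) ^ n = 1 := by
    rw [key3]
    exact pointAlong_pow_eq_one f t (y ≫ lam) hc
  -- (4) `x` along `t` is still killed by `q`
  have hx' : ((A.torsionSectionAlong n f t x : (A.baseChange (t ≫ f)).torsionSections n) : (A.baseChange (t ≫ f)).Sections) ≫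
      baseChangeHom q (t ≫ f) = 1 := by
    rw [coe_torsionSectionAlong, sectionAlong_comp_baseChangeHom, hx, map_one]
  -- (5) ★ `Ker q ⟂ q^∨(Ĉ[n])` over `T′`, moved to the point `λ y` along `t`, read through ★ `weilUnit_baseChange`
  have h5 := weilUnit_comp_dualIsogenyOver_eq_one_of_comp_baseChangeHom_eq_one q DA DC hDA hDC n (t ≫ f) c' hc'n hc''
    (A.torsionSectionAlong n f t x) hx'
  rw [DA.weilUnit_congr_point hDA n (t ≫ f) key3 hc'' (pointAlong_pow_eq_one f t (y ≫ lam) hc) (A.torsionSectionAlong n f t x),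
    DA.weilUnit_baseChange hDA n f (y ≫ lam) hc t x] at h5
  -- (6) units descend along the fppf cover `t`
  exact appTop_injective_of_epi t (h5.trans (map_one t.appTop.hom).symm)

end Descent

end Literature.AlgebraicGeometry.AbelianSchemes.AbelianSchemeOver.DualPair

end
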